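import Literature.NumberTheory.EllipticCurves.SupersingularDensitySerreTraceProofs
import Literature.NumberTheory.EllipticCurves.ModPIrreducibleCongruenceTransferProofs
import Literature.NumberTheory.EllipticCurves.SerreOpenImageDeterminantProofs
import Mathlib.LinearAlgebra.Trace
import Mathlib.LinearAlgebra.Determinant
import HarnessLib

/-!
# Crux `CornerAtThreeW` (item stmt-BirchSwinnertonDyer-21420; 19111 `CornerAtThree` aside), conjunct (U), the (B6) residue at the exempted carrier:
# THE TRACE AT THE PRIMES `ℓ ≡ 2 (mod 3)` — on a mod-`3` image of exponent `4` (the split-Cartan-normaliser type 3Ns, `D₈`) EVERY good prime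
# `ℓ ≡ 2 (mod 3)` has `3 ∣ a_ℓ(E)`; conversely a good `ℓ ≡ 2 (mod 3)` with `3 ∤ a_ℓ` carries a Frobenius of order `8` on `E[3]`
# (cell `bsd-stepL`, seat `bsd-stepL-corner3-p2` g13 = WIDTH-LEVER lane B; `--supports stmt-BirchSwinnertonDyer-21420 --as helper`)

WHY. After r15 of the line of record `Cruxes/CornerAtThreeW/Lines/inert.lean` the only non-print, non-analytic input of the (U)-side is the
(B6) label of the CM family of `X_{N⁺,N⁻}` at the EXEMPTED carrier `q₁` of the up-to-one frames (`ShimuraWalk.PrimitivesWithB6TDAtThree`), a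
prime that is SPLIT in the Friedberg–Hoffstein frame. The ideator bsd-idea-9 g7 (cell INBOX 2026-08-28T13:03:53Z, «an auxiliary norm kills the
component») discharges such a label in receptacle currency from the norm relation (B4) at an auxiliary prime `ℓ₀` INERT in `K` with
`p^e ∣ [K[mℓ₀] : K[m]] = ℓ₀ + 1` and `p ∤ a_{ℓ₀}(E)`. At `p = 3` the first condition forces `ℓ₀ ≡ 2 (mod 3)`, i.e. `det ρ̄_{E,3}(Frob_{ℓ₀}) = −1`,
and in `GL₂(𝔽₃)` an element of determinant `−1` has NON-ZERO trace iff it has ORDER `8` (§1: if `det x = −1` and `tr x ≠ 0` then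
`x² = (tr x)·x + 1` and `x⁴ = −1`). Hence (§2): when the image `ρ̄_{E,3}(Γ_ℚ)` has exponent dividing `4` — the type 3Ns = `N(C_s) ≅ D₈`, which is
the type of ALL FIVE census consumers of the label (168222b1, 278850il1, 364485k1, 493680gx1, 493680hj1; x11b3 corner census) — EVERY good prime
`ℓ ≡ 2 (mod 3)` has `3 ∣ a_ℓ(E)`: the auxiliary-norm route is VOID there (`three_dvd_frobeniusTrace_of_two_mod_three_of_pow_four_eq_one`). And (§3)
a good prime `ℓ ≡ 2 (mod 3)` with `3 ∤ a_ℓ(E)` exhibits a Frobenius of order `8` on `E[3]` — the image contains `C_ns`-type elements (3Nn),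
where the route is alive (`orderOf_galoisRepTorsion_frobenius_eq_eight`). Inputs, all kernel theorems of the tree: the frame of `Aut(E[3])`
(`exists_frame_galoisRepTorsion_rat`), `tr ρ̄(Frob_ℓ) = a_ℓ` and `det ρ̄(Frob_ℓ) = ℓ` on `E[3]` at a good `ℓ ≠ 3`
(`trace_galoisRepTorsion_frobenius_eq`, `det_galoisRepTorsion_frobenius_eq`), and a `decide` over the `3⁴` quadruples of entries.

HONEST FRAMING: structure theorems about mod-`3` Galois images (no named fact, no definition, no `sorry`); NO corner, rank or (ram) hypothesis is
used; nothing here proves the crux, a registered stub, or BSD for any class; no census number moves (T7). 21420 ∕ 19111 NOT closed; BSD is proved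
for no curve. [cite: Serre1972, §2.5–2.6 (element orders in GL₂(𝔽₃)), §2.2 (Cartan normalisers)] [cite: Serre1981, §8.1 eq. (238) (p. 188)]
[cite: GrossLMS1991, §3 Prop. 3.7 (1) (the norm relation the auxiliary prime feeds)]
-/

set_option linter.dupNamespace false -- `Summit.BirchSwinnertonDyer.BirchSwinnertonDyer` (summit = problem), tree-wide
set_option autoImplicit false

noncomputable section

open scoped Classical NumberField

namespace Summit.BirchSwinnertonDyer.BirchSwinnertonDyer.Theorems.CornerShape

open Matrix WeierstrassCurve NumberField IsDedekindDomain Field Rat.HeightOneSpectrum IsDedekindDomain.HeightOneSpectrum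
  Literature.NumberTheory.GaloisRepresentations Literature.NumberTheory.EllipticCurves

/-! ### §1. `GL₂(𝔽₃)`: determinant `−1` and non-zero trace force `x⁴ = −1` (order `8`) -/

/-- The entry-wise certificate (`3⁴` cases, kernel `decide`): over `𝔽₃`, `det A = −1` and `tr A ≠ 0` give `A⁴ = −1` entry by entry
(`A² = (tr A)·A + 1`, `(tr A)² = 1`). [cite: Serre1972, §2.5] -/
private theorem entries_pow_four_of_det_eq_neg_one_of_trace_ne_zero :
    ∀ a b c d : ZMod 3, a * d - b * c = -1 → a + d ≠ 0 →
      (a * a + b * c) * (a * a + b * c) + (a * b + b * d) * (c * a + d * c) = -1 ∧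
      (a * a + b * c) * (a * b + b * d) + (a * b + b * d) * (c * b + d * d) = 0 ∧
      (c * a + d * c) * (a * a + b * c) + (c * b + d * d) * (c * a + d * c) = 0 ∧
      (c * a + d * c) * (a * b + b * d) + (c * b + d * d) * (c * b + d * d) = -1 := by
  decide

/-- **In `GL₂(𝔽₃)`, an element of determinant `−1` and non-zero trace has fourth power `−1`** (its characteristic polynomial
`t² ∓ t − 1` is irreducible over `𝔽₃`, its eigenvalues are the elements of norm `−1` of `𝔽₉`, of order `8`). [cite: Serre1972, §2.5–2.6] -/
theorem pow_four_eq_neg_one_of_det_eq_neg_one_of_trace_ne_zero {M : GL (Fin 2) (ZMod 3)}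
    (hdet : Matrix.det (M : Matrix (Fin 2) (Fin 2) (ZMod 3)) = -1)
    (htr : Matrix.trace (M : Matrix (Fin 2) (Fin 2) (ZMod 3)) ≠ 0) : M ^ 4 = -1 := by
  set A : Matrix (Fin 2) (Fin 2) (ZMod 3) := (M : Matrix (Fin 2) (Fin 2) (ZMod 3)) with hA
  rw [Matrix.det_fin_two] at hdet
  rw [Matrix.trace_fin_two] at htr
  obtain ⟨h00, h01, h10, h11⟩ :=
    entries_pow_four_of_det_eq_neg_one_of_trace_ne_zero (A 0 0) (A 0 1) (A 1 0) (A 1 1) hdet htr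
  apply Units.ext
  rw [Units.val_pow_eq_pow_val, Units.val_neg, Units.val_one, show (4 : ℕ) = 2 + 2 from rfl, pow_add, sq, ← hA]
  ext i j
  fin_cases i <;> fin_cases j <;>
    simp only [Matrix.mul_apply, Fin.sum_univ_two, Matrix.neg_apply, Matrix.one_apply, Fin.isValue, Fin.zero_eta, Fin.mk_one,
      if_true, one_ne_zero, zero_ne_one, if_false, neg_zero] <;>
    first | exact h00 | exact h01 | exact h10 | exact h11

/-- **In `GL₂(𝔽₃)`, an element of determinant `−1` whose fourth power is `1` has trace `0`** (contrapositive of the previous lemma: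
the elements of determinant `−1` and trace `0` are the involutions `diag(1, −1)`-type, of order `2`). [cite: Serre1972, §2.5–2.6] -/
theorem trace_eq_zero_of_det_eq_neg_one_of_pow_four_eq_one {M : GL (Fin 2) (ZMod 3)}
    (hdet : Matrix.det (M : Matrix (Fin 2) (Fin 2) (ZMod 3)) = -1) (h4 : M ^ 4 = 1) :
    Matrix.trace (M : Matrix (Fin 2) (Fin 2) (ZMod 3)) = 0 := by
  by_contra htr
  have h := pow_four_eq_neg_one_of_det_eq_neg_one_of_trace_ne_zero hdet htr
  rw [h4] at h
  exact absurd h (by decide)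

/-- **In `GL₂(𝔽₃)`, an element of determinant `−1` and non-zero trace has order exactly `8`.** [cite: Serre1972, §2.5–2.6] -/
theorem orderOf_eq_eight_of_det_eq_neg_one_of_trace_ne_zero {M : GL (Fin 2) (ZMod 3)}
    (hdet : Matrix.det (M : Matrix (Fin 2) (Fin 2) (ZMod 3)) = -1)
    (htr : Matrix.trace (M : Matrix (Fin 2) (Fin 2) (ZMod 3)) ≠ 0) : orderOf M = 8 := by
  have h4 := pow_four_eq_neg_one_of_det_eq_neg_one_of_trace_ne_zero hdet htr
  have h8 : M ^ 8 = 1 := by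
    rw [show (8 : ℕ) = 4 + 4 from rfl, pow_add, h4, neg_mul_neg, one_mul]
  have hne : ¬ M ^ 4 = 1 := by rw [h4]; decide
  rw [show (8 : ℕ) = 2 ^ (2 + 1) from rfl] at h8 ⊢
  exact orderOf_eq_prime_pow (by rwa [show (2 : ℕ) ^ 2 = 4 from rfl]) h8

/-! ### §2. Exponent-`4` images: `3 ∣ a_ℓ` at every good `ℓ ≡ 2 (mod 3)` -/

variable (W : WeierstrassCurve ℚ) [W.IsElliptic] [W.IsGloballyMinimal]

/-- The determinant and the trace of an arithmetic Frobenius at a good `ℓ ≠ 3` on `E[3]`, read in the tree's frame `(e, Φ)` of `Aut(E[3])`: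
`det = ℓ` and `tr = a_ℓ` (mod `3`). Transport of `det_galoisRepTorsion_frobenius_eq` ∕ `trace_galoisRepTorsion_frobenius_eq` through the frame.
-- adapted from Summits/BirchSwinnertonDyer/BirchSwinnertonDyer/Theorems/ErratumRoadFiveNonSurjCornerFrobeniusOrders.lean
[cite: Serre1981, §8.1 eq. (238) (p. 188)] [cite: SilvermanAEC2009, C.21 Remark 21.3] -/
theorem det_and_trace_frame_frobenius_three [Fact (Nat.Prime 3)]
    (e : geomTorsion W (3 : ℕ) ≃+ (Fin 2 → ZMod 3))
    (Φ : Multiplicative (AddAut (geomTorsion W (3 : ℕ))) ≃* GL (Fin 2) (ZMod 3))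
    (he : ∀ (g : Multiplicative (AddAut (geomTorsion W (3 : ℕ)))) (x : geomTorsion W (3 : ℕ)),
      e (Multiplicative.toAdd g x) = ((Φ g : GL (Fin 2) (ZMod 3)) : Matrix (Fin 2) (Fin 2) (ZMod 3)) *ᵥ e x)
    (htr : letI : Module (ZMod 3) (geomTorsion W (3 : ℕ)) := AddSubgroup.torsionBy.zmodModule
      ∀ g : Multiplicative (AddAut (geomTorsion W (3 : ℕ))),
        Matrix.trace ((Φ g : GL (Fin 2) (ZMod 3)) : Matrix (Fin 2) (Fin 2) (ZMod 3)) =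
          LinearMap.trace (ZMod 3) (geomTorsion W (3 : ℕ)) ((Multiplicative.toAdd g).toAddMonoidHom.toZModLinearMap 3))
    (ℓ : ℕ) [hℓ : Fact ℓ.Prime] (hℓ3 : ℓ ≠ 3) (hgood : W.HasGoodReductionAtPrime ℓ)
    {w : HeightOneSpectrum (𝓞 ℚ)} (hw : (primesEquiv w : ℕ) = ℓ) {𝔓 : Ideal (absIntegers (𝓞 ℚ) ℚ)} (h𝔓 : 𝔓 ∈ w.primesAbove)
    {σ : absoluteGaloisGroup ℚ} (hσ : IsArithFrobAt (𝓞 ℚ) σ 𝔓) :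
    Matrix.det ((Φ (galoisRepTorsion W (3 : ℕ) σ) : GL (Fin 2) (ZMod 3)) : Matrix (Fin 2) (Fin 2) (ZMod 3)) = (ℓ : ZMod 3) ∧
    Matrix.trace ((Φ (galoisRepTorsion W (3 : ℕ) σ) : GL (Fin 2) (ZMod 3)) : Matrix (Fin 2) (Fin 2) (ZMod 3)) =
      (W.frobeniusTrace ℓ : ZMod 3) := by
  letI : Module (ZMod 3) (geomTorsion W (3 : ℕ)) := AddSubgroup.torsionBy.zmodModule
  set x : GL (Fin 2) (ZMod 3) := Φ (galoisRepTorsion W (3 : ℕ) σ) with hxdef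
  refine ⟨?_, ?_⟩
  · rw [← W.det_galoisRepTorsion_frobenius_eq 3 hℓ3 hgood hw h𝔓 hσ]
    have hσM : ∀ Q : geomTorsion W (3 : ℕ), e (σ • Q) = (x : Matrix (Fin 2) (Fin 2) (ZMod 3)) *ᵥ e Q := fun Q ↦ by
      rw [← galoisRepTorsion_apply]; exact he _ Q
    let eL : geomTorsion W (3 : ℕ) ≃ₗ[ZMod 3] (Fin 2 → ZMod 3) :=
      LinearEquiv.ofBijective (e.toAddMonoidHom.toZModLinearMap 3) ⟨e.injective, e.surjective⟩
    have heL : ∀ Q : geomTorsion W (3 : ℕ), eL Q = e Q := fun _ ↦ rfl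
    have hconj : Matrix.toLin' (x : Matrix (Fin 2) (Fin 2) (ZMod 3)) =
        eL.conj ((galoisRepTorsion W (3 : ℕ) σ).toAdd.toAddMonoidHom.toZModLinearMap 3) := by
      refine LinearMap.ext fun u ↦ ?_
      obtain ⟨Q, rfl⟩ := eL.surjective u
      rw [LinearEquiv.conj_apply_apply, eL.symm_apply_apply, heL, heL, Matrix.toLin'_apply]
      change (x : Matrix (Fin 2) (Fin 2) (ZMod 3)) *ᵥ (e Q) = e (σ • Q)
      rw [hσM]
    rw [← LinearMap.det_toLin' (x : Matrix (Fin 2) (Fin 2) (ZMod 3)), hconj, LinearEquiv.conj_apply,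
      LinearMap.comp_assoc, LinearMap.det_conj]
  · rw [hxdef, htr]
    exact W.trace_galoisRepTorsion_frobenius_eq 3 hℓ3 hgood hw h𝔓 hσ

/-- **Exponent-`4` mod-`3` image ⟹ `3 ∣ a_ℓ(E)` at every good prime `ℓ ≡ 2 (mod 3)`.** For an elliptic curve `E = W/ℚ` in global minimal
form whose mod-`3` image has exponent dividing `4` (`ρ̄_{E,3}(σ)⁴ = 1` for all `σ` — the split-Cartan-normaliser type 3Ns, `N(C_s) ≅ D₈`, as on
all five census consumers of the line's (B6) label) and every good prime `ℓ ≡ 2 (mod 3)`: `3 ∣ a_ℓ(E)`. (A Frobenius at `ℓ` has determinant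
`ℓ = −1` on `E[3]` and fourth power `1`, hence trace `0` by §1.) Consequence recorded for the line: an auxiliary prime `ℓ₀` inert in `K` with
`3 ∣ ℓ₀ + 1` ALWAYS has `3 ∣ a_{ℓ₀}` on such a curve — the «auxiliary norm» discharge of the (B6) label is void on the type 3Ns. No corner
hypothesis is used. [cite: Serre1972, §2.2, §2.5–2.6] [cite: Serre1981, §8.1 eq. (238) (p. 188)] -/
theorem three_dvd_frobeniusTrace_of_two_mod_three_of_pow_four_eq_one
    (h4 : ∀ σ : absoluteGaloisGroup ℚ, galoisRepTorsion W (3 : ℕ) σ ^ 4 = 1)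
    (ℓ : ℕ) [hℓ : Fact ℓ.Prime] (hℓ2 : ℓ % 3 = 2) (hgood : W.HasGoodReductionAtPrime ℓ) :
    (3 : ℤ) ∣ W.frobeniusTrace ℓ := by
  haveI : Fact (Nat.Prime 3) := ⟨Nat.prime_three⟩
  have hℓ3 : ℓ ≠ 3 := by rintro rfl; simp at hℓ2
  obtain ⟨e, Φ, he, htr, -⟩ := exists_frame_galoisRepTorsion_rat W 3
  -- an arithmetic Frobenius `σ` at a prime above `ℓ`
  obtain ⟨w, hw⟩ : ∃ w : HeightOneSpectrum (𝓞 ℚ), (primesEquiv w : ℕ) = ℓ :=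
    ⟨primesEquiv.symm ⟨ℓ, hℓ.out⟩, by rw [Equiv.apply_symm_apply]⟩
  obtain ⟨𝔓, h𝔓⟩ := HeightOneSpectrum.primesAbove_nonempty w
  obtain ⟨σ, hσ⟩ := HeightOneSpectrum.exists_isArithFrobAt_of_mem_primesAbove_holds h𝔓
  obtain ⟨hdet, htrace⟩ := det_and_trace_frame_frobenius_three W e Φ he htr ℓ hℓ3 hgood hw h𝔓 hσ
  -- `det = ℓ = −1`, fourth power `1` ⟹ trace `0`
  have hℓneg : (ℓ : ZMod 3) = -1 := by
    rw [← ZMod.natCast_mod ℓ 3, hℓ2]; exact rfl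
  have hx4 : Φ (galoisRepTorsion W (3 : ℕ) σ) ^ 4 = 1 := by rw [← map_pow, h4, map_one]
  have h0 := trace_eq_zero_of_det_eq_neg_one_of_pow_four_eq_one (hdet.trans hℓneg) hx4
  rw [htrace] at h0
  exact (ZMod.intCast_zmod_eq_zero_iff_dvd _ 3).mp h0

/-! ### §3. A good `ℓ ≡ 2 (mod 3)` with `3 ∤ a_ℓ` carries a Frobenius of order `8` on `E[3]` -/

/-- **A Frobenius of order `8` on `E[3]`.** For `E = W/ℚ` in global minimal form, a good prime `ℓ ≡ 2 (mod 3)` with `3 ∤ a_ℓ(E)`, and any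
arithmetic Frobenius `σ` at a prime of `ℤ̄` above `ℓ`: `ρ̄_{E,3}(σ)` has order `8` (determinant `−1`, non-zero trace, §1) — so the mod-`3` image
contains an element of non-split-Cartan type (on the corner: the type 3Nn, where the «auxiliary norm» route for the (B6) label is alive).
No corner hypothesis is used. [cite: Serre1972, §2.2, §2.5–2.6] [cite: Serre1981, §8.1 eq. (238) (p. 188)] -/
theorem orderOf_galoisRepTorsion_frobenius_eq_eight (ℓ : ℕ) [hℓ : Fact ℓ.Prime] (hℓ2 : ℓ % 3 = 2)
    (hgood : W.HasGoodReductionAtPrime ℓ) (ha : ¬ (3 : ℤ) ∣ W.frobeniusTrace ℓ)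
    {w : HeightOneSpectrum (𝓞 ℚ)} (hw : (primesEquiv w : ℕ) = ℓ) {𝔓 : Ideal (absIntegers (𝓞 ℚ) ℚ)} (h𝔓 : 𝔓 ∈ w.primesAbove)
    {σ : absoluteGaloisGroup ℚ} (hσ : IsArithFrobAt (𝓞 ℚ) σ 𝔓) :
    orderOf (galoisRepTorsion W (3 : ℕ) σ) = 8 := by
  haveI : Fact (Nat.Prime 3) := ⟨Nat.prime_three⟩
  have hℓ3 : ℓ ≠ 3 := by rintro rfl; simp at hℓ2
  obtain ⟨e, Φ, he, htr, -⟩ := exists_frame_galoisRepTorsion_rat W 3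
  obtain ⟨hdet, htrace⟩ := det_and_trace_frame_frobenius_three W e Φ he htr ℓ hℓ3 hgood hw h𝔓 hσ
  have hℓneg : (ℓ : ZMod 3) = -1 := by
    rw [← ZMod.natCast_mod ℓ 3, hℓ2]; exact rfl
  have htr0 : Matrix.trace ((Φ (galoisRepTorsion W (3 : ℕ) σ) : GL (Fin 2) (ZMod 3)) : Matrix (Fin 2) (Fin 2) (ZMod 3)) ≠ 0 := by
    rw [htrace]
    exact fun h ↦ ha ((ZMod.intCast_zmod_eq_zero_iff_dvd _ 3).mp h)
  have h8 := orderOf_eq_eight_of_det_eq_neg_one_of_trace_ne_zero (hdet.trans hℓneg) htr0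
  rwa [MulEquiv.orderOf_eq] at h8

/-- **The dichotomy at `p = 3`, contrapositive form**: if some good prime `ℓ ≡ 2 (mod 3)` has `3 ∤ a_ℓ(E)`, the mod-`3` image does NOT have
exponent dividing `4` (it is not of type 3Ns). [cite: Serre1972, §2.2, §2.5–2.6] -/
theorem exists_pow_four_ne_one_of_not_three_dvd_frobeniusTrace (ℓ : ℕ) [hℓ : Fact ℓ.Prime] (hℓ2 : ℓ % 3 = 2)
    (hgood : W.HasGoodReductionAtPrime ℓ) (ha : ¬ (3 : ℤ) ∣ W.frobeniusTrace ℓ) :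
    ∃ σ : absoluteGaloisGroup ℚ, galoisRepTorsion W (3 : ℕ) σ ^ 4 ≠ 1 := by
  by_contra h
  push Not at h
  exact ha (three_dvd_frobeniusTrace_of_two_mod_three_of_pow_four_eq_one W h ℓ hℓ2 hgood)

end Summit.BirchSwinnertonDyer.BirchSwinnertonDyer.Theorems.CornerShape

end
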